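import Summits.CriticalPhenomena.PercolationContinuityZ3.Theorems.PercExchangeRateTransportCriticalCurveRegular
import Summits.CriticalPhenomena.PercolationContinuityZ3.Theorems.PercExchangeRateTransportModelFacts
import Summits.CriticalPhenomena.PercolationContinuityZ3.Theorems.SubcritExchangeUniformity.Negative.Objects

/-!
# Line `isotropic_tangency` — fwd-rung G1 (gen 2) over `CriticalCurveRegular`
# (crux K⁺ `SupercritExchangeUniformity`, item stmt-CriticalPhenomena-16061; route `PercExchangeRateTransport`)

RUNG (forward generator G1, seed `Cruxes.CriticalCurveRegular.Locmod.CriticalCurveRegular_proof`, item 16065):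
`IsotropicTangency` = the anisotropic critical curve `t ↦ p_c(t)` of the route's label-coupled bond family on
`ℤ²×ℤ` (x/y-bonds open iff `U_e ≤ p`, z-bonds iff `U_e ≤ t`) is DIFFERENTIABLE AT THE ISOTROPIC POINT
`t = p₃ := p_c(ℤ³)` WITH SLOPE `−1/2` — the Clausius–Clapeyron value forced by cubic symmetry (z-bonds are one
third of the bonds: the finite-volume exchange rate `a_n = ∂_tΘ_n/∂_pΘ_n` is `1/2` EXACTLY on the diagonal for
every `n`, tree: `…SubcritExchangeUniformity.Negative.Diag.deriv_p_eq_two_mul_deriv_t_diag`, `Anchor.isotropic_anchor`).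
It is the `K = {−1/2}` member of the graded family `IsoTangentWithin K` = floor ∧ "the difference quotients
`(p_c(p₃+h) − p_c(p₃))/h` eventually lie within `ε` of `K`", monotone in `K`, whose `K = univ` member IS the floor
(`isoTangentWithin_univ_iff`, two lines from the seed).  Intermediate members: `K = [−C, 0]` (one-sided Lipschitz
germ — what the floor's PROOF gives, see below), `K = [−C, −c]` (two-sided Aizenman–Grimmett comparability, the
`exchange_comparability` rung of the twin crux K⁻), `K = {−1/2}` (this rung); the route's cruxes continue the ladder to
`p_c ∈ C¹(0,1)` with `p_c′ = −a∘curve`.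

WHY ABOVE THE FLOOR. The floor's engine is the one-sided Aizenman–Grimmett shear `θ(p,t) ≤ θ(p + C(t−s), s)`
(`Locmod.theta_shear`, `C = μ₀^{-N}·2^N·N`, `N = 750`, from the COST of one local modification): it transports
positivity of `θ` across levels up to the constant `C`, hence continuity (indeed a one-sided Lipschitz bound) of
`p_c`, and nothing about the VALUE of the slope: constants-level comparability is the method's ceiling (Grimmett 1999
§3.3 p.58).  The rung asks for the shear constant to be SHARP TO FIRST ORDER at the one point where its sharp value is
known a priori (`1/2`, by symmetry), from both sides: `θ(p,t) ≤ θ(p + (1/2+η)h, t−h)` and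
`θ(p,t) ≤ θ(p − (1/2−η)h, t+h)` for `(p,t)` near `(p₃,p₃)` and small `h ≥ 0`, every `η > 0` — i.e. `θ` is
nondecreasing along every direction of the open cone between the lines of slope `−2/(1±2η)` through the isotropic
point.  These are the two registered stubs; the kernel-checked composition `IsotropicTangency_of` is the
percolation-free `tangent_core` (transport of positivity along the two cone edges pins the difference quotients of
`p_c` at `p₃` into `[−1/2−η, −1/2+η]`) fed with `p_c(p₃) = p₃` (`pcurve_iso`, the route's DiagonalOnCurve, PROVED here
from `modelFacts_proof` (9), the tree's phase structure of `θ_{ℤ³}` and the floor's continuity at `p₃`).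

RELATION TO THE CRUX AND TO S.  `SupercritExchangeUniformity ∧ SubcritExchangeUniformity` (with the landed
`CriticalCurveRegular`, `ModelFacts`, and the diagonal pinning `a(p₃,p₃) = σ(p₃) = 1/2`,
`…Negative.DiagonalPinning`, `…Negative.sigma_eq_half_at_diagonal`) give `|a_n − 1/2| ≤ η` on a ball around
`(p₃,p₃)` for `n ≥ m(η)`, hence both stubs (directional monotonicity of every `Θ_n`, `n ≥ m`, passed to
`θ = ⨅ Θ_n`), hence the rung: the rung is a NECESSARY CONDITION OF THE ROUTE'S TWO OPEN CRUXES — the typed form of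
the route header's "K± predict `p_c′(t) = −1/2` at `t = p_c(ℤ³)` … a stand-alone check" and of the K⁺ strategist's
isotropic germ S4 in integrated (derivative-free) form.  It is NOT a consequence of the sub-problem statement
`PercolationContinuityZ3` (which constrains `θ` only on the closed quadrant `{max(p,t) ≤ p₃}` and says nothing about
the slope of the curve): `on_path = false` by design, declared in the line card; the rung is OFF the S-ladder and ON
the route's mechanism ladder (floor `C⁰` → rung `C¹`-at-`p₃` with the symmetric slope → cruxes `C¹` on `(0,1)`).
-/

noncomputable section

namespace Summit.CriticalPhenomena.PercolationContinuityZ3.Cruxes.SupercritExchangeUniformity.IsoTangent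

open Summit.CriticalPhenomena.PercolationContinuityZ3.Theses.PercExchangeRateTransport
open Summit.CriticalPhenomena.PercolationContinuityZ3.Theorems.SubcritExchangeUniformity.Negative
  (thetaPerc pcurve)

/-! ### The family, the rung, the floor -/

/-- FAMILY (graded by `K ⊆ ℝ`, monotone in `K`). The floor `CriticalCurveRegular` over the landed names
(`pcurve = pc`, `thetaPerc = θ` of the route's `let`s, by `rfl`) AND: the difference quotients of the critical
curve at the isotropic point `p₃ = p_c(ℤ³)` eventually lie within `ε` of the set `K`, for every `ε > 0`. -/
def IsoTangentWithin (K : Set ℝ) : Prop :=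
  (ContinuousOn pcurve (Set.Ioo 0 1) ∧ ∀ t ∈ Set.Ioo (0 : ℝ) 1, 0 < pcurve t ∧ pcurve t < 1) ∧
    ∀ ε > (0 : ℝ), ∃ δ > (0 : ℝ), ∀ h : ℝ, h ≠ 0 → |h| < δ →
      ∃ k ∈ K, |(pcurve (Literature.Probability.Percolation.criticalProb
          (Literature.Probability.LatticeModels.zdGraph 3) (0 : Literature.Probability.LatticeModels.Site 3) + h) -
        pcurve (Literature.Probability.Percolation.criticalProb
          (Literature.Probability.LatticeModels.zdGraph 3) (0 : Literature.Probability.LatticeModels.Site 3))) / h - k| ≤ ε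

/-- RUNG. The critical curve is differentiable at the isotropic point with slope `−1/2`:
the family at `K = {−1/2}`. -/
def IsotropicTangency : Prop := IsoTangentWithin {-(1 / 2 : ℝ)}

/-- The floor, literally, over the landed names (definitional unfolding of the route's `let`s). -/
theorem criticalCurveRegular_iff_named :
    CriticalCurveRegular ↔
      (ContinuousOn pcurve (Set.Ioo 0 1) ∧ ∀ t ∈ Set.Ioo (0 : ℝ) 1, 0 < pcurve t ∧ pcurve t < 1) :=
  Iff.rfl

/-- The family is monotone in the parameter `K`. -/
theorem isoTangentWithin_mono {K K' : Set ℝ} (hK : K ⊆ K') : IsoTangentWithin K → IsoTangentWithin K' := by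
  rintro ⟨h1, h2⟩
  refine ⟨h1, fun ε hε => ?_⟩
  obtain ⟨δ, hδ, h⟩ := h2 ε hε
  refine ⟨δ, hδ, fun x hx hxδ => ?_⟩
  obtain ⟨k, hk, hh⟩ := h x hx hxδ
  exact ⟨k, hK hk, hh⟩

/-- Any real number is within `ε` of `Set.univ` (the vacuous quotient clause of the floor member). -/
theorem exists_mem_univ_close (q ε : ℝ) (hε : 0 < ε) : ∃ k ∈ (Set.univ : Set ℝ), |q - k| ≤ ε :=
  ⟨q, Set.mem_univ _, by rw [sub_self, abs_zero]; exact hε.le⟩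

/-- FLOOR CASE (F3): the family at `K = univ` holds, by the landed seed theorem (the quotient clause is vacuous). -/
theorem isoTangentWithin_univ : IsoTangentWithin Set.univ :=
  ⟨criticalCurveRegular_iff_named.1
    Summit.CriticalPhenomena.PercolationContinuityZ3.Cruxes.CriticalCurveRegular.Locmod.CriticalCurveRegular_proof,
    fun ε hε => ⟨1, one_pos, fun _ _ _ => exists_mem_univ_close _ ε hε⟩⟩

/-- … and the floor is literally the `K = univ` member (both directions). -/
theorem isoTangentWithin_univ_iff : IsoTangentWithin Set.univ ↔ CriticalCurveRegular :=
  ⟨fun h => criticalCurveRegular_iff_named.2 h.1,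
    fun h => ⟨criticalCurveRegular_iff_named.1 h, fun ε hε => ⟨1, one_pos, fun _ _ _ => exists_mem_univ_close _ ε hε⟩⟩⟩

/-- The rung hands back the floor. -/
theorem criticalCurveRegular_of_isotropicTangency : IsotropicTangency → CriticalCurveRegular := fun h =>
  isoTangentWithin_univ_iff.1 (isoTangentWithin_mono (Set.subset_univ _) h)


/-! ### Real-variable core (percolation-free)

For `θ : ℝ → ℝ → ℝ` nondecreasing in `p` (and in `t`), threshold curve
`pc t = sInf ({p ∈ [0,1] | 0 < θ p t} ∪ {1})`:
* `onCurve_core` — the curve passes through the isotropic point, `pc p₃ = p₃` (diagonal identity + phase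
  structure of the diagonal + continuity of `pc` at `p₃`; the route's DiagonalOnCurve);
* `tangent_core` — if `θ` is nondecreasing along the directions `(1/2+η, −1)` and `(−(1/2−η), +1)` near
  `(p₃,p₃)` for every `η > 0` (the two stubs), then the difference quotients of `pc` at `p₃` tend to `−1/2`. -/

section Core

variable {θ : ℝ → ℝ → ℝ} {pc : ℝ → ℝ} {p₃ : ℝ}

theorem critSet_nonempty (θ : ℝ → ℝ → ℝ) (t : ℝ) :
    ({p : ℝ | 0 ≤ p ∧ p ≤ 1 ∧ 0 < θ p t} ∪ {1}).Nonempty :=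
  ⟨1, Or.inr rfl⟩

theorem critSet_bddBelow (θ : ℝ → ℝ → ℝ) (t : ℝ) :
    BddBelow ({p : ℝ | 0 ≤ p ∧ p ≤ 1 ∧ 0 < θ p t} ∪ {1}) :=
  ⟨0, by
    rintro p (⟨hp, -⟩ | hp)
    · exact hp
    · rw [Set.mem_singleton_iff] at hp; rw [hp]; exact zero_le_one⟩

/-- `0 ≤ pc t`. -/
theorem pc_nonneg_core (hpc : ∀ t, pc t = sInf ({p : ℝ | 0 ≤ p ∧ p ≤ 1 ∧ 0 < θ p t} ∪ {1})) (t : ℝ) :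
    0 ≤ pc t := by
  rw [hpc]
  refine le_csInf (critSet_nonempty θ t) ?_
  rintro p (⟨hp, -⟩ | hp)
  · exact hp
  · rw [Set.mem_singleton_iff] at hp; rw [hp]; exact zero_le_one

/-- A point of `[0,1]` where `θ > 0` bounds `pc t` from above. -/
theorem pc_le_of_pos_core (hpc : ∀ t, pc t = sInf ({p : ℝ | 0 ≤ p ∧ p ≤ 1 ∧ 0 < θ p t} ∪ {1}))
    {t q : ℝ} (h0 : 0 ≤ q) (h1 : q ≤ 1) (hpos : 0 < θ q t) : pc t ≤ q := by
  rw [hpc]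
  exact csInf_le (critSet_bddBelow θ t) (Or.inl ⟨h0, h1, hpos⟩)

/-- Strictly above `pc t` (and inside `[0,1]`) the density is positive (monotonicity in `p`). -/
theorem pos_of_pc_lt_core (hpc : ∀ t, pc t = sInf ({p : ℝ | 0 ≤ p ∧ p ≤ 1 ∧ 0 < θ p t} ∪ {1}))
    (hθ_mp : ∀ t p q, p ≤ q → θ p t ≤ θ q t) {t q : ℝ} (hq : pc t < q) (h1 : q ≤ 1) :
    0 < θ q t := by
  rw [hpc] at hq
  obtain ⟨s, hs, hsq⟩ := exists_lt_of_csInf_lt (critSet_nonempty θ t) hq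
  rcases hs with ⟨-, -, hpos⟩ | hs
  · exact hpos.trans_le (hθ_mp t s q hsq.le)
  · rw [Set.mem_singleton_iff] at hs
    rw [hs] at hsq
    exact absurd h1 (not_le.mpr hsq)

/-- **Transport of positivity between two levels.** If for every `q` slightly above `pc t₁` the shifted
point `q + c` lies in `[0,1]` and has `θ (q + c) t₂ > 0`, then `pc t₂ ≤ pc t₁ + c`. -/
theorem pc_transport_core (hpc : ∀ t, pc t = sInf ({p : ℝ | 0 ≤ p ∧ p ≤ 1 ∧ 0 < θ p t} ∪ {1}))
    {t₁ t₂ c r : ℝ} (hr : 0 < r)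
    (H : ∀ q, pc t₁ < q → q < pc t₁ + r → 0 ≤ q + c ∧ q + c ≤ 1 ∧ 0 < θ (q + c) t₂) :
    pc t₂ ≤ pc t₁ + c := by
  by_contra hcon
  have hlt : pc t₁ + c < pc t₂ := not_le.mp hcon
  set g := min r (pc t₂ - (pc t₁ + c)) with hg
  have hgpos : 0 < g := lt_min hr (by linarith)
  have hgr : g ≤ r := min_le_left _ _
  have hgd : g ≤ pc t₂ - (pc t₁ + c) := min_le_right _ _
  obtain ⟨h0, h1, hpos⟩ := H (pc t₁ + g / 2) (by linarith) (by linarith)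
  have := pc_le_of_pos_core hpc h0 h1 hpos
  linarith

/-- Core, part 1: `pc p₃ = p₃` — the critical curve passes through the isotropic point. -/
theorem onCurve_core {th3 : unitInterval → ℝ}
    (hpc : ∀ t, pc t = sInf ({p : ℝ | 0 ≤ p ∧ p ≤ 1 ∧ 0 < θ p t} ∪ {1}))
    (hθ_mp : ∀ t p q, p ≤ q → θ p t ≤ θ q t)
    (hθ_mt : ∀ p s t, s ≤ t → θ p s ≤ θ p t)
    (hdiag : ∀ p : unitInterval, θ p p = th3 p)
    (hpcc : ContinuousWithinAt pc (Set.Ioo 0 1) p₃)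
    (h3l : 0 < p₃) (h3u : p₃ < 1)
    (h3zero : ∀ p : unitInterval, (p : ℝ) < p₃ → th3 p = 0)
    (h3pos : ∀ p : unitInterval, p₃ < (p : ℝ) → 0 < th3 p) :
    pc p₃ = p₃ := by
  have hpick : ∀ a b c : ℝ, 0 < a → 0 < b → 0 < c →
      ∃ s, 0 < s ∧ s < a ∧ s < b ∧ s ≤ c / 2 := fun a b c ha hb hc => by
    refine ⟨min a (min b c) / 2, ?_, ?_, ?_, ?_⟩
    · have : 0 < min a (min b c) := lt_min ha (lt_min hb hc); linarith
    · have : min a (min b c) ≤ a := min_le_left _ _; linarith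
    · have : min a (min b c) ≤ b := (min_le_right _ _).trans (min_le_left _ _); linarith
    · have : min a (min b c) ≤ c := (min_le_right _ _).trans (min_le_right _ _); linarith
  have hle_pc : ∀ t c, c ≤ 1 → (∀ p, 0 ≤ p → p < c → θ p t ≤ 0) → c ≤ pc t :=
      fun t c hc1 hzero => by
    rw [hpc]
    refine le_csInf (critSet_nonempty θ t) ?_
    rintro p (⟨hp0, -, hpos⟩ | hp)
    · by_contra hlt
      exact absurd (hzero p hp0 (not_le.mp hlt)) (not_le.mpr hpos)
    · rw [Set.mem_singleton_iff] at hp; rw [hp]; exact hc1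
  -- (A) below the isotropic critical point the curve lies above the diagonal
  have hA : ∀ t, 0 < t → t < p₃ → t ≤ pc t := fun t ht0 ht3 => by
    have ht1 : t ≤ 1 := (ht3.trans h3u).le
    refine hle_pc t t ht1 fun p _ hpt => ?_
    have e : θ t t = th3 ⟨t, ht0.le, ht1⟩ := hdiag ⟨t, ht0.le, ht1⟩
    have hz : th3 ⟨t, ht0.le, ht1⟩ = 0 := h3zero ⟨t, ht0.le, ht1⟩ ht3
    calc θ p t ≤ θ t t := hθ_mp t p t hpt.le
      _ = 0 := by rw [e, hz]
  -- (B) above it the curve lies below the level p₃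
  have hB : ∀ t, p₃ < t → t < 1 → pc t ≤ p₃ := fun t ht3 ht1 => by
    by_contra hcon'
    have hcon := not_le.mp hcon'
    obtain ⟨q, hq3, hqpc, hqt⟩ : ∃ q, p₃ < q ∧ q < pc t ∧ q < t :=
      ⟨min ((p₃ + pc t) / 2) ((p₃ + t) / 2), lt_min (by linarith) (by linarith),
        (min_le_left _ _).trans_lt (by linarith), (min_le_right _ _).trans_lt (by linarith)⟩
    have hq0 : 0 ≤ q := (h3l.trans hq3).le
    have hq1 : q ≤ 1 := (hqt.trans ht1).le
    have hpos : 0 < θ q t := by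
      have e : θ q q = th3 ⟨q, hq0, hq1⟩ := hdiag ⟨q, hq0, hq1⟩
      have hp : 0 < th3 ⟨q, hq0, hq1⟩ := h3pos ⟨q, hq0, hq1⟩ hq3
      calc (0 : ℝ) < θ q q := by rw [e]; exact hp
        _ ≤ θ q t := hθ_mt q q t hqt.le
    exact absurd (pc_le_of_pos_core hpc hq0 hq1 hpos) (not_le.mpr hqpc)
  -- (C) continuity of the curve at p₃ pins the isotropic point onto the curve
  rw [Metric.continuousWithinAt_iff] at hpcc
  apply le_antisymm
  · by_contra hcon'
    have hcon := not_le.mp hcon'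
    obtain ⟨δ, hδ, hδ'⟩ := hpcc ((pc p₃ - p₃) / 2) (by linarith)
    obtain ⟨s, hs0, hsδ, hs1, -⟩ := hpick δ (1 - p₃) 1 hδ (by linarith) one_pos
    have hmem : p₃ + s ∈ Set.Ioo (0 : ℝ) 1 := ⟨by linarith, by linarith⟩
    have hdist : dist (p₃ + s) p₃ < δ := by
      rw [Real.dist_eq, show p₃ + s - p₃ = s by ring, abs_of_pos hs0]; exact hsδ
    have h := hδ' hmem hdist
    rw [Real.dist_eq] at h
    have hBt := hB (p₃ + s) (by linarith) (by linarith)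
    have h' := (abs_sub_lt_iff.mp h).2
    linarith
  · by_contra hcon'
    have hcon := not_le.mp hcon'
    obtain ⟨δ, hδ, hδ'⟩ := hpcc ((p₃ - pc p₃) / 2) (by linarith)
    obtain ⟨s, hs0, hsδ, hs3, hsε⟩ := hpick δ p₃ (p₃ - pc p₃) hδ h3l (by linarith)
    have hmem : p₃ - s ∈ Set.Ioo (0 : ℝ) 1 := ⟨by linarith, by linarith⟩
    have hdist : dist (p₃ - s) p₃ < δ := by
      rw [Real.dist_eq, show p₃ - s - p₃ = -s by ring, abs_neg, abs_of_pos hs0]; exact hsδ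
    have h := hδ' hmem hdist
    rw [Real.dist_eq] at h
    have hAt := hA (p₃ - s) (by linarith) (by linarith)
    have h' := (abs_sub_lt_iff.mp h).1
    linarith

/-- Core, part 2 (**the composition's engine**): two-sided SHARP shear at the isotropic point ⇒ the
difference quotients of `pc` at `p₃` converge to `−1/2`.  From `hup` (lowering `t` by `h` costs at most
`(1/2+η)h` in `p`) positivity is transported to give `(pc(p₃+h) − p₃)/h ≥ −(1/2+η)`; from `hlo` (raising `t`
by `h` saves at least `(1/2−η)h` in `p`) one gets `≤ −(1/2−η)`; both for `h` of either sign. -/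
theorem tangent_core
    (hpc : ∀ t, pc t = sInf ({p : ℝ | 0 ≤ p ∧ p ≤ 1 ∧ 0 < θ p t} ∪ {1}))
    (hθ_mp : ∀ t p q, p ≤ q → θ p t ≤ θ q t)
    (h3l : 0 < p₃) (h3u : p₃ < 1) (hC : pc p₃ = p₃)
    (hpcc : ContinuousWithinAt pc (Set.Ioo 0 1) p₃)
    (hup : ∀ η : ℝ, 0 < η → ∃ δ : ℝ, 0 < δ ∧ ∀ p t h : ℝ, |p - p₃| ≤ δ → |t - p₃| ≤ δ → 0 ≤ h → h ≤ δ →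
      θ p t ≤ θ (p + (1 / 2 + η) * h) (t - h))
    (hlo : ∀ η : ℝ, 0 < η → ∃ δ : ℝ, 0 < δ ∧ ∀ p t h : ℝ, |p - p₃| ≤ δ → |t - p₃| ≤ δ → 0 ≤ h → h ≤ δ →
      θ p t ≤ θ (p - (1 / 2 - η) * h) (t + h)) :
    ∀ ε : ℝ, 0 < ε → ∃ δ : ℝ, 0 < δ ∧ ∀ h : ℝ, h ≠ 0 → |h| < δ →
      |(pc (p₃ + h) - pc p₃) / h + 1 / 2| ≤ ε := by
  intro ε hε
  -- tolerance η = min ε 1/4, so that both slopes 1/2 ± η lie in [1/4, 3/4]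
  set η := min ε (1 / 4) with hηdef
  have hη : 0 < η := lt_min hε (by norm_num)
  have hηε : η ≤ ε := min_le_left _ _
  have hη4 : η ≤ 1 / 4 := min_le_right _ _
  obtain ⟨δ₁, hδ₁, hup'⟩ := hup η hη
  obtain ⟨δ₂, hδ₂, hlo'⟩ := hlo η hη
  -- master scale M ≤ δ₁, δ₂, p₃, 1 - p₃
  set M := min (min δ₁ δ₂) (min p₃ (1 - p₃)) with hMdef
  have hM : 0 < M := lt_min (lt_min hδ₁ hδ₂) (lt_min h3l (by linarith))
  have hM₁ : M ≤ δ₁ := (min_le_left _ _).trans (min_le_left _ _)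
  have hM₂ : M ≤ δ₂ := (min_le_left _ _).trans (min_le_right _ _)
  have hM₃ : M ≤ p₃ := (min_le_right _ _).trans (min_le_left _ _)
  have hM₄ : M ≤ 1 - p₃ := (min_le_right _ _).trans (min_le_right _ _)
  -- continuity of pc at p₃, tolerance M/4
  rw [Metric.continuousWithinAt_iff] at hpcc
  obtain ⟨δ₃, hδ₃, hcont⟩ := hpcc (M / 4) (by linarith)
  refine ⟨min (M / 4) δ₃, lt_min (by linarith) hδ₃, fun h hh0 hhδ => ?_⟩
  have hhM : |h| < M / 4 := lt_of_lt_of_le hhδ (min_le_left _ _)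
  have hh3 : |h| < δ₃ := lt_of_lt_of_le hhδ (min_le_right _ _)
  obtain ⟨hhl, hhu⟩ := abs_lt.mp hhM
  have ht01 : p₃ + h ∈ Set.Ioo (0 : ℝ) 1 := ⟨by linarith, by linarith⟩
  have hπ : |pc (p₃ + h) - p₃| < M / 4 := by
    have := hcont ht01 (by rw [Real.dist_eq, show p₃ + h - p₃ = h by ring]; exact hh3)
    rwa [Real.dist_eq, hC] at this
  obtain ⟨hπl, hπu⟩ := abs_lt.mp hπ
  have hpc0 : 0 ≤ pc (p₃ + h) := pc_nonneg_core hpc _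
  rw [hC, abs_le]
  rcases lt_or_gt_of_ne hh0 with hneg | hpos
  · -- h < 0: the level t = p₃ + h lies below p₃; write k = -h > 0
    have hk : 0 < -h := by linarith
    -- (d) transport from level p₃+h UP to level p₃ along (-(1/2-η), +1): p₃ ≤ pc(p₃+h) - (1/2-η)k
    have hD : pc p₃ ≤ pc (p₃ + h) + (-((1 / 2 - η) * (-h))) := by
      refine pc_transport_core hpc (r := M / 4) (by linarith) fun q hq1 hq2 => ?_
      have hθq : 0 < θ q (p₃ + h) := pos_of_pc_lt_core hpc hθ_mp hq1 (by linarith)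
      have hq3 : |q - p₃| ≤ δ₂ := by rw [abs_le]; constructor <;> linarith
      have hsh := hlo' q (p₃ + h) (-h) hq3
        (by rw [show p₃ + h - p₃ = h by ring]; exact hhM.le.trans (by linarith)) hk.le (by linarith)
      rw [show p₃ + h + -h = p₃ by ring] at hsh
      have hP0 : 0 ≤ (1 / 2 - η) * (-h) := mul_nonneg (by linarith) hk.le
      have hP1 : (1 / 2 - η) * (-h) ≤ 1 / 2 * (-h) := mul_le_mul_of_nonneg_right (by linarith) hk.le
      refine ⟨by linarith, by linarith, ?_⟩
      rw [show q + -((1 / 2 - η) * -h) = q - (1 / 2 - η) * -h by ring]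
      exact hθq.trans_le hsh
    -- (a) transport from level p₃ DOWN to level p₃+h along (1/2+η, -1): pc(p₃+h) ≤ p₃ + (1/2+η)k
    have hA : pc (p₃ + h) ≤ pc p₃ + (1 / 2 + η) * (-h) := by
      refine pc_transport_core hpc (r := M / 4) (by linarith) fun q hq1 hq2 => ?_
      rw [hC] at hq1 hq2
      have hθq : 0 < θ q p₃ := pos_of_pc_lt_core hpc hθ_mp (by rw [hC]; exact hq1) (by linarith)
      have hq3 : |q - p₃| ≤ δ₁ := by rw [abs_le]; constructor <;> linarith
      have hsh := hup' q p₃ (-h) hq3 (by rw [sub_self, abs_zero]; exact hδ₁.le) hk.le (by linarith)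
      rw [show p₃ - -h = p₃ + h by ring] at hsh
      have hP0 : 0 ≤ (1 / 2 + η) * (-h) := mul_nonneg (by linarith) hk.le
      have hP1 : (1 / 2 + η) * (-h) ≤ 3 / 4 * (-h) := mul_le_mul_of_nonneg_right (by linarith) hk.le
      exact ⟨by linarith, by linarith, hθq.trans_le hsh⟩
    rw [hC] at hD hA
    constructor
    · have hq : -(1 / 2 + η) ≤ (pc (p₃ + h) - p₃) / h := by
        rw [le_div_iff_of_neg hneg]; linarith
      linarith
    · have hq : (pc (p₃ + h) - p₃) / h ≤ -(1 / 2 - η) := by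
        rw [div_le_iff_of_neg hneg]; linarith
      linarith
  · -- h > 0: the level t = p₃ + h lies above p₃
    -- (b) transport from level p₃+h DOWN to level p₃ along (1/2+η, -1): p₃ ≤ pc(p₃+h) + (1/2+η)h
    have hB : pc p₃ ≤ pc (p₃ + h) + (1 / 2 + η) * h := by
      refine pc_transport_core hpc (r := M / 4) (by linarith) fun q hq1 hq2 => ?_
      have hθq : 0 < θ q (p₃ + h) := pos_of_pc_lt_core hpc hθ_mp hq1 (by linarith)
      have hq3 : |q - p₃| ≤ δ₁ := by rw [abs_le]; constructor <;> linarith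
      have hsh := hup' q (p₃ + h) h hq3
        (by rw [show p₃ + h - p₃ = h by ring]; exact hhM.le.trans (by linarith)) hpos.le (by linarith)
      rw [show p₃ + h - h = p₃ by ring] at hsh
      have hP0 : 0 ≤ (1 / 2 + η) * h := mul_nonneg (by linarith) hpos.le
      have hP1 : (1 / 2 + η) * h ≤ 3 / 4 * h := mul_le_mul_of_nonneg_right (by linarith) hpos.le
      exact ⟨by linarith, by linarith, hθq.trans_le hsh⟩
    -- (c) transport from level p₃ UP to level p₃+h along (-(1/2-η), +1): pc(p₃+h) ≤ p₃ - (1/2-η)h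
    have hCc : pc (p₃ + h) ≤ pc p₃ + (-((1 / 2 - η) * h)) := by
      refine pc_transport_core hpc (r := M / 4) (by linarith) fun q hq1 hq2 => ?_
      rw [hC] at hq1 hq2
      have hθq : 0 < θ q p₃ := pos_of_pc_lt_core hpc hθ_mp (by rw [hC]; exact hq1) (by linarith)
      have hq3 : |q - p₃| ≤ δ₂ := by rw [abs_le]; constructor <;> linarith
      have hsh := hlo' q p₃ h hq3 (by rw [sub_self, abs_zero]; exact hδ₂.le) hpos.le (by linarith)
      have hP0 : 0 ≤ (1 / 2 - η) * h := mul_nonneg (by linarith) hpos.le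
      have hP1 : (1 / 2 - η) * h ≤ 1 / 2 * h := mul_le_mul_of_nonneg_right (by linarith) hpos.le
      refine ⟨by linarith, by linarith, ?_⟩
      rw [show q + -((1 / 2 - η) * h) = q - (1 / 2 - η) * h by ring]
      exact hθq.trans_le hsh
    rw [hC] at hB hCc
    constructor
    · have hq : -(1 / 2 + η) ≤ (pc (p₃ + h) - p₃) / h := by
        rw [le_div_iff₀ hpos]; linarith
      linarith
    · have hq : (pc (p₃ + h) - p₃) / h ≤ -(1 / 2 - η) := by
        rw [div_le_iff₀ hpos]; linarith
      linarith

end Core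


/-! ### Instantiation at the route's family -/

/-- `p₃ = p_c(ℤ³)`, the isotropic critical density (input notation only). -/
local notation "𝔭₃" => Literature.Probability.Percolation.criticalProb
  (Literature.Probability.LatticeModels.zdGraph 3) (0 : Literature.Probability.LatticeModels.Site 3)

/-- `θ(p,t)` is nondecreasing in `p` (the seed file's pathwise coupling `Locmod.theta_mono`, by `rfl` on names). -/
theorem thetaPerc_mono_p (t p q : ℝ) (h : p ≤ q) : thetaPerc p t ≤ thetaPerc q t :=
  Summit.CriticalPhenomena.PercolationContinuityZ3.Cruxes.CriticalCurveRegular.Locmod.theta_mono h le_rfl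

/-- `θ(p,t)` is nondecreasing in `t`. -/
theorem thetaPerc_mono_t (p s t : ℝ) (h : s ≤ t) : thetaPerc p s ≤ thetaPerc p t :=
  Summit.CriticalPhenomena.PercolationContinuityZ3.Cruxes.CriticalCurveRegular.Locmod.theta_mono le_rfl h

/-- `0 < p_c(ℤ³) < 1` (tree fact). -/
theorem p3_mem_Ioo : (0 : ℝ) < 𝔭₃ ∧ 𝔭₃ < 1 :=
  Literature.Probability.Percolation.Grimmett1999_criticalProb_pos_lt_one_holds 3 (by norm_num)

/-- **DiagonalOnCurve, proved**: the anisotropic critical curve passes through the isotropic point,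
`p_c(p₃) = p₃` — from `modelFacts_proof` (9) (`θ(p,p) = θ_{ℤ³}(p)`), the tree's phase structure of `θ_{ℤ³}`
around `p_c(ℤ³)`, monotonicity of `θ`, and continuity of `p_c` at `p₃` (the floor). -/
theorem pcurve_iso : pcurve 𝔭₃ = 𝔭₃ := by
  obtain ⟨hcc1, -⟩ :=
    Summit.CriticalPhenomena.PercolationContinuityZ3.Cruxes.CriticalCurveRegular.Locmod.CriticalCurveRegular_proof
  obtain ⟨-, -, -, -, -, -, -, -, h9, -⟩ :=
    Summit.CriticalPhenomena.PercolationContinuityZ3.Theorems.ModelFacts.modelFacts_proof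
  exact onCurve_core (θ := thetaPerc) (pc := pcurve)
    (th3 := Literature.Probability.Percolation.theta (Literature.Probability.LatticeModels.zdGraph 3) 0)
    (fun _ => rfl) thetaPerc_mono_p thetaPerc_mono_t h9 (hcc1 _ p3_mem_Ioo) p3_mem_Ioo.1 p3_mem_Ioo.2
    (fun p hp => Literature.Probability.Percolation.theta_eq_zero_of_lt_criticalProb_holds _ _ p hp)
    (fun p hp => Literature.Probability.Percolation.theta_pos_of_criticalProb_lt_holds _ _ p hp)

/-! ### SKELETON: two registered stubs and the kernel-checked composition -/

/-- **Stub 1 — sharp UPPER shear at the isotropic point** (the floor's Aizenman–Grimmett shear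
`θ(p,t) ≤ θ(p + C h, t − h)` with its constant `C = μ₀^{-N}2^N N` replaced by the first-order sharp value
`1/2 + η` near `(p₃,p₃)`): for every `η > 0` there is `δ > 0` such that lowering the vertical density by `h`
and raising the horizontal density by `(1/2+η)h` does not decrease `θ`, for `(p,t)` within `δ` of the
isotropic point and `0 ≤ h ≤ δ`.  Equivalently: `a_n = ∂_tΘ_n/∂_pΘ_n ≤ 1/2 + η` near `(p₃,p₃)` for all large
`n` (then every `Θ_n`, `n ≥ m`, is nondecreasing along `(1/2+η, −1)`, and so is `θ = ⨅_{n ≥ m} Θ_n`); the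
K⁺-germ "window flatness at the symmetric point", where `a_n(p,p) = 1/2` EXACTLY for every `n`
(`Negative.Diag.deriv_p_eq_two_mul_deriv_t_diag`).  Why it might fail: a corner of the critical curve at the
isotropic point (`limsup a_n > 1/2` along some approach); MC: `a_n(p₃ + x n^{-1/ν}, p₃) − 1/2 = O(n^{-1/ν})`
(kit j023385/j026653). -/
theorem stub_isoUpperShear :
    ∀ η : ℝ, 0 < η → ∃ δ : ℝ, 0 < δ ∧ ∀ p t h : ℝ, |p - 𝔭₃| ≤ δ → |t - 𝔭₃| ≤ δ → 0 ≤ h → h ≤ δ →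
      thetaPerc p t ≤ thetaPerc (p + (1 / 2 + η) * h) (t - h) := by
  sorry

/-- **Stub 2 — sharp LOWER shear at the isotropic point** (the reverse Aizenman–Grimmett direction — vertical
bonds are essential too — again with the first-order sharp constant): for every `η > 0` there is `δ > 0` such
that raising the vertical density by `h` allows lowering the horizontal density by `(1/2−η)h` without
decreasing `θ`, near `(p₃,p₃)`, `0 ≤ h ≤ δ`.  Equivalently `a_n ≥ 1/2 − η` near `(p₃,p₃)` for all large `n`;
the K⁻-germ (`σ(p₃) = 1/2`, `Negative.sigma_eq_half_at_diagonal`) in integrated form.  Why it might fail: as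
stub 1 with `liminf a_n < 1/2`; also the constants-level version (`a_n ≥ κ > 0`, the twin crux's
`LowerExchangeComparability`) is itself open. -/
theorem stub_isoLowerShear :
    ∀ η : ℝ, 0 < η → ∃ δ : ℝ, 0 < δ ∧ ∀ p t h : ℝ, |p - 𝔭₃| ≤ δ → |t - 𝔭₃| ≤ δ → 0 ≤ h → h ≤ δ →
      thetaPerc p t ≤ thetaPerc (p - (1 / 2 - η) * h) (t + h) := by
  sorry

/-- **COMPOSITION (kernel-checked, no `sorry`): stub 1 → stub 2 → `IsotropicTangency`.**  The floor conjunct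
is the seed theorem; the quotient clause is `tangent_core` at the route's family, fed with `pcurve_iso`,
monotonicity of `θ` in `p`, `0 < p₃ < 1` and continuity of `p_c` at `p₃` (the floor again). -/
theorem IsotropicTangency_of
    (hup : ∀ η : ℝ, 0 < η → ∃ δ : ℝ, 0 < δ ∧ ∀ p t h : ℝ, |p - 𝔭₃| ≤ δ → |t - 𝔭₃| ≤ δ → 0 ≤ h → h ≤ δ →
      thetaPerc p t ≤ thetaPerc (p + (1 / 2 + η) * h) (t - h))
    (hlo : ∀ η : ℝ, 0 < η → ∃ δ : ℝ, 0 < δ ∧ ∀ p t h : ℝ, |p - 𝔭₃| ≤ δ → |t - 𝔭₃| ≤ δ → 0 ≤ h → h ≤ δ →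
      thetaPerc p t ≤ thetaPerc (p - (1 / 2 - η) * h) (t + h)) :
    IsotropicTangency := by
  have hCC :=
    Summit.CriticalPhenomena.PercolationContinuityZ3.Cruxes.CriticalCurveRegular.Locmod.CriticalCurveRegular_proof
  refine ⟨criticalCurveRegular_iff_named.1 hCC, fun ε hε => ?_⟩
  obtain ⟨hcc1, -⟩ := hCC
  obtain ⟨δ, hδ, H⟩ := tangent_core (θ := thetaPerc) (pc := pcurve) (fun _ => rfl) thetaPerc_mono_p
    p3_mem_Ioo.1 p3_mem_Ioo.2 pcurve_iso (hcc1 _ p3_mem_Ioo) hup hlo ε hε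
  refine ⟨δ, hδ, fun h hh0 hhδ => ⟨-(1 / 2), Set.mem_singleton _, ?_⟩⟩
  rw [sub_neg_eq_add]
  exact H h hh0 hhδ

/-- The rung from the two registered stubs. -/
theorem isotropicTangency_of_stubs : IsotropicTangency :=
  IsotropicTangency_of stub_isoUpperShear stub_isoLowerShear

/-- Skeleton-registration alias (`ledger skeleton check --crux-decl …IsoTangent.IsotropicTangency`): the RUNG modulo the
two stubs (forward brief F2 — the skeleton of a rung line concludes the rung, not the crux). -/
theorem IsotropicTangency_proof : IsotropicTangency := isotropicTangency_of_stubs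

/-- **Reading of the rung in Mathlib terms**: `IsotropicTangency` gives `HasDerivAt p_c (−1/2) p₃`. -/
theorem hasDerivAt_pcurve_of_isotropicTangency (h : IsotropicTangency) :
    HasDerivAt pcurve (-(1 / 2 : ℝ)) 𝔭₃ := by
  rw [hasDerivAt_iff_tendsto_slope_zero, Metric.tendsto_nhdsWithin_nhds]
  intro ε hε
  obtain ⟨δ, hδ, hq⟩ := h.2 (ε / 2) (half_pos hε)
  refine ⟨δ, hδ, fun x hx hxδ => ?_⟩
  have hx0 : x ≠ 0 := hx
  rw [dist_eq_norm, Real.norm_eq_abs, sub_zero] at hxδ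
  obtain ⟨k, hk, hkε⟩ := hq x hx0 hxδ
  rw [Set.mem_singleton_iff] at hk
  rw [hk, sub_neg_eq_add] at hkε
  rw [Real.dist_eq, smul_eq_mul, inv_mul_eq_div, sub_neg_eq_add]
  linarith [hkε]

/-- The composition places the rung ABOVE the floor in the graded family:
`IsoTangentWithin univ` (floor) ← `IsoTangentWithin {−1/2}` (rung), and the rung is equivalent to
floor ∧ `HasDerivAt`-with-slope-`−1/2` reading above. -/
theorem rung_above_floor : IsotropicTangency → IsoTangentWithin Set.univ :=
  isoTangentWithin_mono (Set.subset_univ _)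

end Summit.CriticalPhenomena.PercolationContinuityZ3.Cruxes.SupercritExchangeUniformity.IsoTangent

end
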